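import Summits.BirchSwinnertonDyer.BirchSwinnertonDyer.Theorems.CMKolyvaginAtInertTwoSilentSupplyOnSelmerRankOneOfBurungaleTian
import Summits.BirchSwinnertonDyer.BirchSwinnertonDyer.Theorems.CMKolyvaginAtInertTwoSilentSupplyOfBurungaleTianSelmerSupply
import HarnessLib

/-!
# Route `CMKolyvaginAtInertTwo`, crux HL′ `CMSilentHeegnerTwinSupplyAtInertTwo` (stmt-BirchSwinnertonDyer-28663) —
# a COMPOSITE-FRIENDLY residual child: HL′ ⟸ Burungale–Tian ∧ modularity ∧ «one-bit Selmer-corank-zero supply off `#Sel₂(E) = 2`»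

Seat `bsd-line-cmk2-p1` g24 (cell `bsd-print-cf2`), `--supports stmt-BirchSwinnertonDyer-28663` (helper; closes nothing by name).
THEOREMS ONLY (no definition, no named fact, no `sorry`).  BSD is NOT proved by this; HL′ is NOT proved by this.

WHY.  The pen's split kit (HOME `ideators/bsd-idea-1/cmk-hl-split/`, glue-by g23's
`cmSilentHeegnerTwinSupply_of_burungaleTian_of_residualSupply`) files the residual of HL′ off `#Sel₂(E/ℚ) = 2` in the PRIME-TWIST form
«∃ prime q, 4N ∣ q+1, ∃ prime ℓ, corank_ℓ Sel_{ℓ^∞}(E^{(−q)}) = 0» (HL‴-shape).  HL′ itself allows COMPOSITE one-bit discriminants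
`d_K = −q₀·m` (`q₀` the unique `F`-inert prime, the primes of `m` `F`-split with `a_q` odd), and the `ℓ = 3` engine (Kriz–Li Thm 1.20 /
3-isogeny descent + 3-indivisibility of class numbers) is in sieve range ONLY on composite frames (pen memo HLPRIME-ATTACK-MEMO-g23 §8b: CN-3″
inside Belabas–Fouvry's system (II), CN-3′ for prime `d` beyond it).  So the residual child should be typed in the ONE-BIT-FIELD form
  HL′₁ᶜ := «∀ W ∈ H₂^{HL} with #Sel₂(W/ℚ) ≠ 2: ∃ K imaginary quadratic, d_K odd ≠ −3, Heegner for N_W, Σ_W(d_K) ≤ 1, ∃ prime ℓ,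
           corank_{ℤ_ℓ} Sel_{ℓ^∞}(W^{(d_K)}/ℚ) = 0»,
which is WEAKER than the prime-twist form (§2) and still glues to HL′ with the same two prints (§3: on `#Sel₂ = 2` g23's Mazur–Rubin field;
off it Burungale–Tian turns corank `0` into `L(W^{(d_K)},1) ≠ 0`).  §1 is g22's universal-frame field construction with the `L`-value
clause replaced by an arbitrary property of the twisting parameter (so that `d_K = −q` is transported, not just `L ≠ 0`).

Alternative kit line for the pen (children texts = the binders of §3 in order; nothing filed by me):
`--split CMSilentHeegnerTwinSupplyAtInertTwo --into [BurungaleTianRankZeroConverse, EntireLFunctionRat, <HL′₁ᶜ as above>]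
 --glue-by Summit.BirchSwinnertonDyer.BirchSwinnertonDyer.Theorems.KolyvaginLowerTwo.cmSilentHeegnerTwinSupply_of_burungaleTian_of_oneBitSelmerSupply`.

References: [BurungaleTian2026] Thm. 1.1; [MazurRubin2010] Cor. 3.4 (i); [GrossLMS1991] §2; [Kramer1981] Prop. 3; [KrizLi2019] Thm. 1.20, §8–§9;
[BelabasFouvry1999] Cor. 1.9.
-/

set_option autoImplicit false
-- the Theorems namespace of this sub repeats the summit name by design (D-0017 nested layout)
set_option linter.dupNamespace false

noncomputable section

open scoped Classical

open WeierstrassCurve NumberField Literature.NumberTheory.EllipticCurves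
  Literature.NumberTheory.EllipticCurves.Rank1Residual
open Summit.BirchSwinnertonDyer.BirchSwinnertonDyer.Theses.CMKolyvaginAtInertTwo (CMSilentHeegnerTwinSupplyAtInertTwo)

namespace Summit.BirchSwinnertonDyer.BirchSwinnertonDyer.Theorems.KolyvaginLowerTwo

/-! ## §1 The universal frame `K = ℚ(√−p)`, `4N ∣ p + 1`, transporting an arbitrary property of the twisting parameter -/

/-- **The one-bit Heegner field `ℚ(√−p)` of a prime `p ≡ −1 (mod 4N_E)`, with `d_K = −p` REMEMBERED through any property `Φ` of the twisting
parameter.**  `W/ℚ` globally minimal with CM, `2` inert in the CM field, `ρ̄_{E,2}` onto; `p` prime with `4·N_W ∣ p + 1`; `Φ (−p)`.  Then there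
is an imaginary quadratic `K` with `d_K` odd, `≠ −3`, every prime of `N_W` split in `K`, `Σ_W(d_K) ≤ 1`, and `Φ (d_K)`.  (g22's
`exists_silentHeegnerField_of_prime_twist` is the case `Φ d := L(W^{(d)},1) ≠ 0`; same proof.) [cite: GrossLMS1991, §2 (Heegner hypothesis)]
[cite: Kramer1981, Prop. 3] -/
theorem exists_oneBitHeegnerField_of_prime_of_prop (W : WeierstrassCurve ℚ) [W.IsElliptic] [W.IsGloballyMinimal]
    [NeZero (W.conductorNorm ℤ)] (hCM : W.HasCM) (hin : Rank1Residual.CMInert W 2) (hρ2 : W.HasSurjectiveModNGaloisRep 2)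
    {p : ℕ} (hp : p.Prime) (hdvd : (4 * W.conductorNorm ℤ : ℕ) ∣ p + 1) (Φ : ℚ → Prop) (hΦ : Φ (-(p : ℚ))) :
    ∃ (K : Type) (_ : Field K) (_ : NumberField K), IsImaginaryQuadratic K ∧ Odd (NumberField.discr K) ∧
      NumberField.discr K ≠ -3 ∧ SatisfiesHeegnerHypothesis (W.conductorNorm ℤ) K ∧
      (∑ q ∈ (NumberField.discr K).natAbs.primeFactors,
        ((if jacobiSym W.Δ.num q = -1 then 1 else 0) + (if jacobiSym W.Δ.num q = 1 ∧ Even (W.frobeniusTrace q) then 2 else 0)) ≤ 1) ∧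
      Φ (NumberField.discr K : ℚ) := by
  set N : ℕ := W.conductorNorm ℤ with hN
  -- `3 ≤ |d_F| ∣ N`, so `12 ≤ 4N ≤ p + 1`
  have hN0 : N ≠ 0 := NeZero.ne N
  obtain ⟨hℓP, hℓ4, -⟩ := ShaCountTwo.prime_natAbs_cmFieldDiscr_of_cmInert_two W hin
  have hℓN : (cmFieldDiscrOfJ W.j).natAbs ∣ N := ShaCountTwo.natAbs_cmFieldDiscr_dvd_conductorNorm W hCM hin hρ2
  have hℓ3 : 3 ≤ (cmFieldDiscrOfJ W.j).natAbs := by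
    have := hℓP.two_le
    omega
  have hN3 : 3 ≤ N := le_trans hℓ3 (Nat.le_of_dvd (Nat.pos_of_ne_zero hN0) hℓN)
  obtain ⟨t, ht⟩ := hdvd
  have h4 : 4 ∣ p + 1 := ⟨N * t, by rw [ht]; ring⟩
  have hp11 : 11 ≤ p := by
    have hk : p + 1 = 4 * (N * t) := by rw [ht]; ring
    have ht0 : 1 ≤ t := by
      rcases Nat.eq_zero_or_pos t with rfl | h
      · omega
      · exact h
    have h3k : 3 ≤ N * t := le_trans hN3 (Nat.le_mul_of_pos_right N ht0)
    generalize N * t = k at hk h3k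
    omega
  -- the fundamental discriminant `D = -p`
  set D : ℤ := -(p : ℤ) with hD
  have hDneg : D < 0 := by
    have : (0 : ℤ) < p := by exact_mod_cast hp.pos
    omega
  have hD4 : D % 4 = 1 := by omega
  have hD1 : D ≠ 1 := by omega
  have hsq : Squarefree D := by
    rw [← Int.squarefree_natAbs, hD, Int.natAbs_neg, Int.natAbs_natCast]
    exact hp.squarefree
  have hB : 0 < D.natAbs := Int.natAbs_pos.mpr hDneg.ne
  -- the Kronecker conditions at the primes of `N`
  have hkr : ∀ q : ℕ, q.Prime → q ∣ N → (q = 2 → D % 8 = 1) ∧ (q ≠ 2 → jacobiSym D q = 1) := by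
    intro q hq hqN
    obtain ⟨u, hu⟩ := hqN
    have h' : p + 1 = 4 * (q * u) * t := by rw [← hu]; exact ht
    refine ⟨fun hq2 ↦ ?_, fun _ ↦ ?_⟩
    · subst hq2
      have h8 : 8 ∣ p + 1 := ⟨u * t, by rw [h']; ring⟩
      omega
    · have hq1 : (1 : ℤ) < q := by exact_mod_cast hq.one_lt
      have hmod : D % q = 1 := by
        have h'' : ((p : ℤ) + 1) = 4 * ((q : ℤ) * u) * t := by exact_mod_cast h'
        have hDq : D = 1 + (q : ℤ) * (-(4 * (u : ℤ) * t)) := by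
          rw [hD]
          linarith
        rw [hDq, Int.add_mul_emod_self_left]
        exact Int.emod_eq_of_lt (by norm_num) hq1
      rw [jacobiSym.mod_left, hmod, jacobiSym.one_left]
  -- the field
  obtain ⟨K, _, _, hK, -, hH, hDK⟩ :=
    (exists_heegnerField_iff_exists_fundamental N 0 (fun D' ↦ D' = D)).mpr
      ⟨D, hDneg, Or.inl ⟨hD4, hsq, hD1⟩, hB, hkr, rfl⟩
  have hodd : Odd (NumberField.discr K) := by
    rw [hDK, Int.odd_iff]
    omega
  have h3 : NumberField.discr K ≠ -3 := by
    rw [hDK]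
    omega
  have hq : (NumberField.discr K).natAbs.Prime := by
    rw [hDK, hD, Int.natAbs_neg, Int.natAbs_natCast]
    exact hp
  refine ⟨K, inferInstance, inferInstance, hK, hodd, h3, hH,
    sum_defect_le_one_of_prime_of_cmInert_two W hCM hin hρ2 K hK hodd hH hq, ?_⟩
  rw [hDK, hD]
  push_cast
  exact hΦ

/-! ## §2 The one-bit Selmer supply is WEAKER than the prime-twist Selmer supply -/

/-- **HL′₁ (prime-twist form, the pen's `CMSilentSupplyResidualOffSelmerTwo`) ⟹ HL′₁ᶜ (one-bit-field form).**  From a prime `q` with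
`4N_W ∣ q + 1` and a prime `ℓ` with `corank_{ℤ_ℓ} Sel_{ℓ^∞}(W^{(−q)}) = 0`, §1 with `Φ d := ∃ ℓ, corank_ℓ Sel(W^{(d)}) = 0` gives the
one-bit Heegner field `K = ℚ(√−q)` carrying the same corank-zero certificate for `W^{(d_K)} = W^{(−q)}`.  Pure bookkeeping; BSD-free.
[cite: GrossLMS1991, §2] -/
theorem oneBitSelmerSupply_of_primeTwistSelmerSupply
    (hRest : ∀ (W : WeierstrassCurve ℚ) [W.IsElliptic] [W.IsGloballyMinimal] [NeZero (W.conductorNorm ℤ)],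
      W.HasCM → Rank1Residual.CMInert W 2 → W.HasSurjectiveModNGaloisRep (2 : ℤ) → W.analyticRank = 1 →
      Nat.card (W.selmerGroup 2) ≠ 2 →
      ∃ q : ℕ, q.Prime ∧ (4 * W.conductorNorm ℤ : ℕ) ∣ q + 1 ∧
        ∃ ℓ : ℕ, ℓ.Prime ∧ (W.quadraticTwist (-(q : ℚ))).selmerCorank ℓ = 0) :
    ∀ (W : WeierstrassCurve ℚ) [W.IsElliptic] [W.IsGloballyMinimal] [NeZero (W.conductorNorm ℤ)],
      W.HasCM → Rank1Residual.CMInert W 2 → W.HasSurjectiveModNGaloisRep (2 : ℤ) → W.analyticRank = 1 →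
      Nat.card (W.selmerGroup 2) ≠ 2 →
      ∃ (K : Type) (_ : Field K) (_ : NumberField K), IsImaginaryQuadratic K ∧ Odd (NumberField.discr K) ∧
        NumberField.discr K ≠ -3 ∧ SatisfiesHeegnerHypothesis (W.conductorNorm ℤ) K ∧
        (∑ q ∈ (NumberField.discr K).natAbs.primeFactors,
          ((if jacobiSym W.Δ.num q = -1 then 1 else 0) + (if jacobiSym W.Δ.num q = 1 ∧ Even (W.frobeniusTrace q) then 2 else 0)) ≤ 1) ∧
        ∃ ℓ : ℕ, ℓ.Prime ∧ (W.quadraticTwist (NumberField.discr K : ℚ)).selmerCorank ℓ = 0 := by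
  intro W _ _ _ hCM hin hρ hr hSel
  obtain ⟨q, hq, hdvd, ℓ, hℓ, h0⟩ := hRest W hCM hin hρ hr hSel
  exact exists_oneBitHeegnerField_of_prime_of_prop W hCM hin hρ hq hdvd
    (fun d ↦ ∃ ℓ : ℕ, ℓ.Prime ∧ (W.quadraticTwist d).selmerCorank ℓ = 0) ⟨ℓ, hℓ, h0⟩

/-! ## §3 HL′ BY NAME from Burungale–Tian ∧ modularity ∧ the one-bit Selmer supply off `#Sel₂(E) = 2` -/

/-- **HL′ (stmt-28663) ⟸ Burungale–Tian 2026 ∧ `hasEntireLFunction_rat` ∧ HL′₁ᶜ** — the `--glue-by` shape for a split of 28663 into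
`[BurungaleTianRankZeroConverse, EntireLFunctionRat, HL′₁ᶜ]`.  On `#Sel₂(W/ℚ) = 2`: g23's Mazur–Rubin field
(`exists_silentHeegnerField_of_natCard_selmerGroup_eq_two`).  Off it: `hRest` gives a one-bit Heegner `K` (composite `d_K` allowed) and a
prime `ℓ` with `corank_{ℤ_ℓ} Sel_{ℓ^∞}(W^{(d_K)}) = 0`; Burungale–Tian (any prime `ℓ`, CM twist, same `j`) gives `r_an(W^{(d_K)}) = 0`, i.e.
`L(W^{(d_K)},1) ≠ 0` (`entireLFunction_twist_ne_zero_of_selmerCorank_eq_zero`).  CONDITIONAL on the two prints and HL′₁ᶜ (open); closes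
nothing by name; BSD / HL′ are NOT proved by this. [cite: BurungaleTian2026, Thm. 1.1] [cite: MazurRubin2010, Cor. 3.4 (i)] [cite: BCDTJAMS2001, Thm. A] -/
theorem cmSilentHeegnerTwinSupply_of_burungaleTian_of_oneBitSelmerSupply
    (hBT : burungaleTian_analyticRank_eq_zero_of_selmerCorank_eq_zero_of_hasCM) (hmod : hasEntireLFunction_rat)
    (hRest : ∀ (W : WeierstrassCurve ℚ) [W.IsElliptic] [W.IsGloballyMinimal] [NeZero (W.conductorNorm ℤ)],
      W.HasCM → Rank1Residual.CMInert W 2 → W.HasSurjectiveModNGaloisRep (2 : ℤ) → W.analyticRank = 1 →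
      Nat.card (W.selmerGroup 2) ≠ 2 →
      ∃ (K : Type) (_ : Field K) (_ : NumberField K), IsImaginaryQuadratic K ∧ Odd (NumberField.discr K) ∧
        NumberField.discr K ≠ -3 ∧ SatisfiesHeegnerHypothesis (W.conductorNorm ℤ) K ∧
        (∑ q ∈ (NumberField.discr K).natAbs.primeFactors,
          ((if jacobiSym W.Δ.num q = -1 then 1 else 0) + (if jacobiSym W.Δ.num q = 1 ∧ Even (W.frobeniusTrace q) then 2 else 0)) ≤ 1) ∧
        ∃ ℓ : ℕ, ℓ.Prime ∧ (W.quadraticTwist (NumberField.discr K : ℚ)).selmerCorank ℓ = 0) :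
    CMSilentHeegnerTwinSupplyAtInertTwo := by
  intro W _ _ _ hCM hin hρ hr
  by_cases h2 : Nat.card (W.selmerGroup 2) = 2
  · exact exists_silentHeegnerField_of_natCard_selmerGroup_eq_two hBT hmod W hCM hin hρ h2
  · obtain ⟨K, _, _, hK, hodd, h3, hH, hdef, ℓ, hℓ, h0⟩ := hRest W hCM hin hρ hr h2
    have hd0 : ((NumberField.discr K : ℤ) : ℚ) ≠ 0 := by exact_mod_cast NumberField.discr_ne_zero K
    exact ⟨K, _, _, hK, hodd, h3, hH, hdef, entireLFunction_twist_ne_zero_of_selmerCorank_eq_zero hBT hmod W hCM hd0 hℓ h0⟩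

/-! ## §4 The plainest split: HL′ restricted to `#Sel₂(E) ≠ 2` as the residual child -/

/-- **HL′ (stmt-28663) ⟸ Burungale–Tian 2026 ∧ `hasEntireLFunction_rat` ∧ HL′|_{#Sel₂ ≠ 2}** — the `--glue-by` shape for the split of 28663
whose residual child is 28663's OWN TEXT with the binder `Nat.card (W.selmerGroup 2) ≠ 2` inserted after `W.analyticRank = 1` (no engine
built in: the child asks for `L(W^{(d_K)},1) ≠ 0` on a one-bit Heegner field, exactly as HL′ does, but only off the cell where g23's
Mazur–Rubin field settles it).  The three residual children offered — prime-twist Selmer form (pen kit), one-bit Selmer form (§3), plain form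
(here) — are successively WEAKER statements; each glues to HL′ with the same two prints.  CONDITIONAL; closes nothing; BSD / HL′ NOT proved.
[cite: BurungaleTian2026, Thm. 1.1] [cite: MazurRubin2010, Cor. 3.4 (i)] -/
theorem cmSilentHeegnerTwinSupply_of_burungaleTian_of_offSelmerTwoSupply
    (hBT : burungaleTian_analyticRank_eq_zero_of_selmerCorank_eq_zero_of_hasCM) (hmod : hasEntireLFunction_rat)
    (hRest : ∀ (W : WeierstrassCurve ℚ) [W.IsElliptic] [W.IsGloballyMinimal] [NeZero (W.conductorNorm ℤ)],
      W.HasCM → Rank1Residual.CMInert W 2 → W.HasSurjectiveModNGaloisRep (2 : ℤ) → W.analyticRank = 1 →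
      Nat.card (W.selmerGroup 2) ≠ 2 →
      ∃ (K : Type) (_ : Field K) (_ : NumberField K), IsImaginaryQuadratic K ∧ Odd (NumberField.discr K) ∧
        NumberField.discr K ≠ -3 ∧ SatisfiesHeegnerHypothesis (W.conductorNorm ℤ) K ∧
        (∑ q ∈ (NumberField.discr K).natAbs.primeFactors,
          ((if jacobiSym W.Δ.num q = -1 then 1 else 0) + (if jacobiSym W.Δ.num q = 1 ∧ Even (W.frobeniusTrace q) then 2 else 0)) ≤ 1) ∧
        (W.quadraticTwist (NumberField.discr K : ℚ)).entireLFunction 1 ≠ 0) :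
    CMSilentHeegnerTwinSupplyAtInertTwo := by
  intro W _ _ _ hCM hin hρ hr
  by_cases h2 : Nat.card (W.selmerGroup 2) = 2
  · exact exists_silentHeegnerField_of_natCard_selmerGroup_eq_two hBT hmod W hCM hin hρ h2
  · exact hRest W hCM hin hρ hr h2

end Summit.BirchSwinnertonDyer.BirchSwinnertonDyer.Theorems.KolyvaginLowerTwo

end
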